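import Literature.GroupTheory.CombinatorialGroupTheory.CyclicBlockInterchangeSurgery
import HarnessLib

/-!
# `d_cbi` through commutator length: the queries of Heuer's reduction (Heuer 2020, Thm. 2, Claim 3.11)

Sequel of `CyclicBlockInterchangeSurgery.lean` (the orbit-counting formula
`2 d_cbi(v,w) = n − max_π orb(σπ)`). [Heuer2020, Thm. 2 (i)] identifies `d_cbi(v, w)` with the
commutator length of the chain `v + w⁻¹`, and Claim 3.11 (§3.3) replaces the chain by single
elements: "`cl(v + w⁻¹) = min { cl(v w̃⁻¹) : w̃ a cyclic conjugate of w }`", whence Thm. 2 (ii):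
"in time `|w|` we may decide `cl(v + w⁻¹) ≤ n` using the decision problem CL-`F(A)`". This file
proves the resulting query characterisation directly from the orbit-counting formula and the
tree's Bardakov–Culler theorem for single words (`CommutatorLengthCertificate.lean`:
`2 cl(u) + v(π) ≤ |u|/2 + 1` for every pairing `π` of a word `u`, and
`|u|/2 + 1 ≤ 2 cl(u) + v(π)` for some pairing when `u ∈ [F, F]`):

* the query word `u = v · w̃⁻¹` (`CBI.cword v w̃ = pos v ++ (pos w̃)⁻¹`, a word of length `2n` in
  the commutator subgroup for related `v, w̃`: `CBI.mk_cword_mem_commutator`);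
* the identification `e : I⁺ ⊔ I⁻ ≃ Fin 2n` of the two circles with the positions of `u`
  (`I⁻` reversed), under which a letter matching `p` becomes a Bardakov pairing `π_p` of `u`
  (`CBI.isPairingFn_pairingOf`) and EVERY pairing of `u` arises this way (`CBI.exists_eq_pairingOf`);
* the cyclic shift of `u` is the two-circle `σ` corrected by one transposition (at the two
  junctions), so `v(π_p) = orb(σπ) ± 1`: `v(π_p) ≤ orb(σπ) + 1` always (`CBI.vtx_pairingOf_le`), with
  equality when `p 0 = 0` (`CBI.vtx_pairingOf_eq`) — the orbit of `0⁺` then splits at the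
  junction, as in the proof of Claim 3.11;
* rotating `w` conjugates `σπ` (`CBI.ncyc_alpha_inv_pow_mul`), so the rotation `w̃ = σ^{p 0} w`
  achieves `p 0 = 0`;
* **`CBI.dcbi_le_iff_exists_cl_le`**: for related words of length `n ≥ 1`,
  `d_cbi(v, w) ≤ k ↔ ∃ i < n, cl(v · (σⁱ w)⁻¹) ≤ k` — the `n` oracle questions of
  [Heuer2020, Thm. 2 (ii)].

Everything here is proved; no named facts.

## References

* [Heuer2020] N. Heuer, *Computing commutator length is hard*, arXiv:2001.10230, §3.2 (Bardakov
  for the chain `v + w⁻¹`), §3.3 (Claim 3.11, proof of Thm. 2 (ii)).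
-/

namespace Literature.GroupTheory.CombinatorialGroupTheory

namespace CBI

open Equiv Equiv.Perm Bardakov

variable {n : ℕ} {β : Type*}

/-! ### The query word `u = v · w̃⁻¹` and its positions -/

/-- The positive word of a list of letters. [cite: Heuer2020, §3.1] -/
def pos (v : List β) : List (β × Bool) := v.map fun b => (b, true)

/-- **The query word** `v · w̃⁻¹` of [Heuer2020, Claim 3.11]. [cite: Heuer2020, Claim 3.11] -/
def cword (v w : List β) : List (β × Bool) := pos v ++ FreeGroup.invRev (pos w)

/-- Length of the query word. [folklore] -/
@[simp] theorem length_cword (v w : List β) : (cword v w).length = v.length + w.length := by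
  simp [cword, pos, FreeGroup.invRev]

/-- The negative word of a list of letters. [folklore] -/
def neg (w : List β) : List (β × Bool) := w.map fun b => (b, false)

/-- `(pos w̃)⁻¹ = (neg w̃).reverse`. [folklore] -/
theorem invRev_pos (w : List β) : FreeGroup.invRev (pos w) = (neg w).reverse := by
  simp [FreeGroup.invRev, pos, neg, List.map_map, Function.comp_def]

/-- Counts in a positive word. [folklore] -/
theorem count_pos [DecidableEq β] (v : List β) (a : β) (s : Bool) :
    (pos v).count (a, s) = if s then v.count a else 0 := by
  induction v with
  | nil => simp [pos]
  | cons x v ih =>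
    simp only [pos, List.map_cons] at ih ⊢
    rw [List.count_cons, List.count_cons, ih]
    by_cases hs : s = true
    · subst hs; simp
    · have hs' : s = false := by simpa using hs
      subst hs'
      simp

/-- Counts in a negative word. [folklore] -/
theorem count_neg [DecidableEq β] (w : List β) (a : β) (s : Bool) :
    (neg w).count (a, s) = if s then 0 else w.count a := by
  induction w with
  | nil => simp [neg]
  | cons x w ih =>
    simp only [neg, List.map_cons] at ih ⊢
    rw [List.count_cons, List.count_cons, ih]
    by_cases hs : s = true
    · subst hs; simp
    · simp only [hs, if_false, Bool.false_eq_true]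
      have hs' : s = false := by simpa using hs
      subst hs'
      simp

/-- Letter counts of the query word: positive letters come from `v`. [folklore] -/
theorem count_cword_true [DecidableEq β] (v w : List β) (a : β) : (cword v w).count (a, true) = v.count a := by
  rw [cword, invRev_pos, List.count_append, List.count_reverse, count_pos, count_neg]
  simp

/-- Letter counts of the query word: negative letters come from `w̃`. [folklore] -/
theorem count_cword_false [DecidableEq β] (v w : List β) (a : β) : (cword v w).count (a, false) = w.count a := by
  rw [cword, invRev_pos, List.count_append, List.count_reverse, count_pos, count_neg]
  simp

/-- **The query word lies in the commutator subgroup** for related `v, w̃`. [cite: Heuer2020, §3.3] -/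
theorem mk_cword_mem_commutator [DecidableEq β] {v w : List β} (h : List.Perm v w) :
    FreeGroup.mk (cword v w) ∈ commutator (FreeGroup β) := by
  rw [mk_mem_commutator_iff_count]
  intro a
  rw [count_cword_true, count_cword_false, h.count_eq]

/-- The identification of the two circles with the positions of `u = v · w̃⁻¹`: `i⁺ ↦ i`,
`j⁻ ↦ n + (n − 1 − j)` (the `w̃`-circle is read backwards in `w̃⁻¹`). [cite: Heuer2020, §3.3] -/
def posEquiv (n : ℕ) : Fin n ⊕ Fin n ≃ Fin (n + n) :=
  (Equiv.sumCongr (Equiv.refl (Fin n)) Fin.revPerm).trans finSumFinEquiv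

/-- `e(i⁺) = i`. [folklore] -/
@[simp] theorem posEquiv_inl (i : Fin n) : posEquiv n (Sum.inl i) = Fin.castAdd n i := by
  simp [posEquiv]

/-- `e(j⁻) = n + rev j`. [folklore] -/
@[simp] theorem posEquiv_inr (j : Fin n) : posEquiv n (Sum.inr j) = Fin.natAdd n (Fin.rev j) := by
  simp [posEquiv]

/-- The query word as a function of positions, through `e`. [folklore] -/
def cwordFn (V W : Fin n → β) (y : Fin (n + n)) : β × Bool :=
  match (posEquiv n).symm y with
  | Sum.inl i => (V i, true)
  | Sum.inr j => (W j, false)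

/-- Letters of `u` on the `v`-circle. [folklore] -/
@[simp] theorem cwordFn_inl (V W : Fin n → β) (i : Fin n) : cwordFn V W (posEquiv n (Sum.inl i)) = (V i, true) := by
  unfold cwordFn
  rw [Equiv.symm_apply_apply]

/-- Letters of `u` on the `w̃`-circle. [folklore] -/
@[simp] theorem cwordFn_inr (V W : Fin n → β) (j : Fin n) : cwordFn V W (posEquiv n (Sum.inr j)) = (W j, false) := by
  unfold cwordFn
  rw [Equiv.symm_apply_apply]

/-- **`u = v · w̃⁻¹` as an `ofFn`.** [folklore] -/
theorem ofFn_cwordFn (V W : Fin n → β) : List.ofFn (cwordFn V W) = cword (List.ofFn V) (List.ofFn W) := by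
  rw [List.ofFn_add, cword, invRev_pos]
  congr 1
  · rw [pos, List.map_ofFn]
    congr 1
    funext i
    rw [Function.comp_apply, ← cwordFn_inl V W i, posEquiv_inl]
    rfl
  · rw [neg, List.map_ofFn]
    apply List.ext_getElem
    · simp
    · intro k hk1 hk2
      rw [List.getElem_ofFn, List.getElem_reverse, List.getElem_ofFn]
      have hk : k < n := by simpa using hk1
      have e : Fin.natAdd n (⟨k, hk⟩ : Fin n) = posEquiv n (Sum.inr ⟨n - 1 - k, by omega⟩) := by
        rw [posEquiv_inr]
        apply Fin.ext
        simp only [Fin.val_natAdd, Fin.val_rev]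
        omega
      rw [show (⟨k, by simpa using hk2⟩ : Fin n) = ⟨k, hk⟩ from rfl, e, cwordFn_inr]
      simp only [Function.comp_apply, List.length_ofFn]

/-! ### Letter matchings are the Bardakov pairings of the query word -/

/-- **The pairing of `u = v · w̃⁻¹` given by a letter matching** `p`: `π_p = e π e⁻¹`. [cite: Heuer2020, §3.3] -/
def pairingOf (p : Perm (Fin n)) : Perm (Fin (n + n)) := (posEquiv n).permCongr (pairing p)

/-- `π_p` on the `v`-positions. [folklore] -/
@[simp] theorem pairingOf_inl (p : Perm (Fin n)) (i : Fin n) :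
    pairingOf p (posEquiv n (Sum.inl i)) = posEquiv n (Sum.inr (p i)) := by
  rw [pairingOf, Equiv.permCongr_apply, Equiv.symm_apply_apply, pairing_inl]

/-- `π_p` on the `w̃⁻¹`-positions. [folklore] -/
@[simp] theorem pairingOf_inr (p : Perm (Fin n)) (j : Fin n) :
    pairingOf p (posEquiv n (Sum.inr j)) = posEquiv n (Sum.inl (p.symm j)) := by
  rw [pairingOf, Equiv.permCongr_apply, Equiv.symm_apply_apply, pairing_inr]

/-- **A letter matching is a Bardakov pairing of the query word.** [cite: Heuer2020, §3.2] -/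
theorem isPairingFn_pairingOf {V W : Fin n → β} {p : Perm (Fin n)} (hp : IsMatching V W p) :
    IsPairingFn (cwordFn V W) (pairingOf p) := by
  refine ⟨fun y => ?_, fun y => ?_, fun y => ?_⟩ <;> obtain ⟨z, rfl⟩ := (posEquiv n).surjective y
  · rw [pairingOf, Equiv.permCongr_apply, Equiv.permCongr_apply, Equiv.symm_apply_apply, Equiv.symm_apply_apply,
      ← Perm.mul_apply, pairing_mul_self, Perm.one_apply]
  · rw [pairingOf, Equiv.permCongr_apply, Equiv.symm_apply_apply, ne_eq, (posEquiv n).injective.eq_iff]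
    exact pairing_apply_ne_self p z
  · rcases z with i | j
    · rw [pairingOf_inl, cwordFn_inl, cwordFn_inr, hp]
      rfl
    · rw [pairingOf_inr, cwordFn_inr, cwordFn_inl, ← hp (p.symm j), Equiv.apply_symm_apply]
      rfl

/-- **Every Bardakov pairing of the query word comes from a letter matching** (a positive letter
can only be paired with a negative one). [cite: Heuer2020, §3.2] -/
theorem exists_eq_pairingOf {V W : Fin n → β} {π : Perm (Fin (n + n))} (hπ : IsPairingFn (cwordFn V W) π) :
    ∃ p : Perm (Fin n), IsMatching V W p ∧ π = pairingOf p := by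
  classical
  obtain ⟨hinv, -, hlet⟩ := hπ
  -- the partner of `i⁺` is some `j⁻` with `W j = V i`
  have key : ∀ i : Fin n, ∃ j : Fin n, π (posEquiv n (Sum.inl i)) = posEquiv n (Sum.inr j) ∧ W j = V i := by
    intro i
    have h := hlet (posEquiv n (Sum.inl i))
    rw [cwordFn_inl] at h
    obtain ⟨z, hz⟩ := (posEquiv n).surjective (π (posEquiv n (Sum.inl i)))
    rcases z with i' | j
    · rw [← hz, cwordFn_inl] at h
      simp [linv] at h
    · refine ⟨j, hz.symm, ?_⟩
      rw [← hz, cwordFn_inr] at h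
      simpa [linv] using h
  choose f hf using key
  have hfinj : Function.Injective f := by
    intro i i' h
    have h1 := (hf i).1
    rw [h, ← (hf i').1] at h1
    exact Sum.inl_injective ((posEquiv n).injective (π.injective h1))
  let p : Perm (Fin n) := Equiv.ofBijective f (Finite.injective_iff_bijective.1 hfinj)
  have hpf : ∀ i, p i = f i := fun _ => rfl
  refine ⟨p, fun i => by rw [hpf]; exact (hf i).2, Equiv.ext fun y => ?_⟩
  obtain ⟨z, rfl⟩ := (posEquiv n).surjective y
  rcases z with i | j
  · rw [pairingOf_inl, hpf]
    exact (hf i).1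
  · rw [pairingOf_inr]
    have h1 := (hf (p.symm j)).1
    rw [← hpf, Equiv.apply_symm_apply] at h1
    rw [← h1, hinv]

/-! ### The cyclic shift of `u` versus `σ`: one transposition at the junctions -/

/-- `permCongr` is multiplicative. [folklore] -/
theorem permCongr_mul' {γ δ : Type*} (e : γ ≃ δ) (f g : Perm γ) : e.permCongr (f * g) = e.permCongr f * e.permCongr g :=
  Equiv.ext fun x => by simp [Equiv.permCongr_apply, Perm.mul_apply]

/-- Powers through `permCongr`. [folklore] -/
theorem permCongr_pow_apply {γ δ : Type*} (e : γ ≃ δ) (f : Perm γ) (k : ℕ) (x : γ) :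
    (e.permCongr f ^ k) (e x) = e ((f ^ k) x) := by
  induction k with
  | zero => simp
  | succ k ih => rw [pow_succ', Perm.mul_apply, ih, Equiv.permCongr_apply, Equiv.symm_apply_apply, pow_succ', Perm.mul_apply]

/-- `SameCycle` through `permCongr`. [folklore] -/
theorem sameCycle_permCongr_iff {γ δ : Type*} [Finite γ] [Finite δ] (e : γ ≃ δ) (f : Perm γ) (x y : γ) :
    (e.permCongr f).SameCycle (e x) (e y) ↔ f.SameCycle x y := by
  constructor
  · intro h
    obtain ⟨k, -, hk⟩ := h.exists_pow_eq'
    rw [permCongr_pow_apply, e.injective.eq_iff] at hk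
    exact ⟨k, by rw [zpow_natCast, hk]⟩
  · intro h
    obtain ⟨k, -, hk⟩ := h.exists_pow_eq'
    exact ⟨k, by rw [zpow_natCast, permCongr_pow_apply, hk]⟩

/-- The last position of the `v`-circle. [folklore] -/
def lastP (hn : 0 < n) : Fin n := ⟨n - 1, by omega⟩

/-- `σ(last) = 0` on a circle. [folklore] -/
theorem finRotate_lastP (hn : 0 < n) : finRotate n (lastP hn) = ⟨0, hn⟩ := by
  apply Fin.ext
  rw [Bardakov.val_finRotate]
  simp [lastP]
  omega

/-- `σ⁻¹(0) = last` on a circle. [folklore] -/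
theorem finRotate_symm_zero (hn : 0 < n) : (finRotate n).symm ⟨0, hn⟩ = lastP hn := by
  rw [Equiv.symm_apply_eq, finRotate_lastP]

/-- **The cyclic shift of `u = v · w̃⁻¹` is the two-circle `σ` followed by the transposition of the
two junction positions** `(n−1)` (last letter of `v`) and `2n − 1` (last letter of `w̃⁻¹`): this is
the comparison of `σ_z` with `σ` in the proof of [Heuer2020, Claim 3.11]. [cite: Heuer2020, Claim 3.11] -/
theorem finRotate_eq_permCongr_sigma_mul_swap (hn : 0 < n) :
    finRotate (n + n) = (posEquiv n).permCongr (sigma n) *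
      swap (posEquiv n (Sum.inl (lastP hn))) (posEquiv n (Sum.inr ⟨0, hn⟩)) := by
  refine Equiv.ext fun y => ?_
  obtain ⟨z, rfl⟩ := (posEquiv n).surjective y
  apply Fin.ext
  rw [Bardakov.val_finRotate, Perm.mul_apply]
  rcases z with i | j
  · by_cases hi : i = lastP hn
    · subst hi
      rw [swap_apply_left, Equiv.permCongr_apply, Equiv.symm_apply_apply, sigma_inr, finRotate_symm_zero,
        posEquiv_inl, posEquiv_inr]
      simp only [lastP, Fin.val_rev, Fin.val_natAdd, Fin.val_castAdd]
      split_ifs <;> omega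
    · have hne : i.val ≠ n - 1 := fun h => hi (Fin.ext (by simp [lastP, h]))
      rw [swap_apply_of_ne_of_ne ((posEquiv n).injective.ne (by simpa using hi))
          ((posEquiv n).injective.ne Sum.inl_ne_inr),
        Equiv.permCongr_apply, Equiv.symm_apply_apply, sigma_inl, posEquiv_inl, posEquiv_inl]
      simp only [Fin.val_castAdd, Bardakov.val_finRotate]
      have := i.isLt
      split_ifs <;> omega
  · by_cases hj : j = ⟨0, hn⟩
    · subst hj
      rw [swap_apply_right, Equiv.permCongr_apply, Equiv.symm_apply_apply, sigma_inl, finRotate_lastP,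
        posEquiv_inr, posEquiv_inl]
      simp only [Fin.val_rev, Fin.val_natAdd, Fin.val_castAdd]
      split_ifs <;> omega
    · have hne : j.val ≠ 0 := fun h => hj (Fin.ext h)
      rw [swap_apply_of_ne_of_ne ((posEquiv n).injective.ne Sum.inr_ne_inl)
          ((posEquiv n).injective.ne (by simpa using hj)),
        Equiv.permCongr_apply, Equiv.symm_apply_apply, sigma_inr, posEquiv_inr, posEquiv_inr]
      simp only [Fin.val_natAdd, Fin.val_rev, val_finRotate_symm', rotInvN, hne, if_false]
      have := j.isLt
      split_ifs <;> omega

/-- **`v(π_p) = orb(swap · e(σπ)e⁻¹)`**: the vertex permutation of the query word is `σπ`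
transported to the positions, times one transposition. [cite: Heuer2020, Claim 3.11] -/
theorem vtx_pairingOf_eq_ncyc (hn : 0 < n) (p : Perm (Fin n)) :
    vtx (n + n) (pairingOf p) =
      ncyc (swap (posEquiv n (Sum.inr (p (lastP hn)))) (posEquiv n (Sum.inl (p.symm ⟨0, hn⟩))) *
        (posEquiv n).permCongr (alpha p)) := by
  have h1 : (pairingOf p)⁻¹ (posEquiv n (Sum.inl (lastP hn))) = posEquiv n (Sum.inr (p (lastP hn))) := by
    rw [Perm.inv_def, Equiv.symm_apply_eq, pairingOf_inr, Equiv.symm_apply_apply]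
  have h2 : (pairingOf p)⁻¹ (posEquiv n (Sum.inr ⟨0, hn⟩)) = posEquiv n (Sum.inl (p.symm ⟨0, hn⟩)) := by
    rw [Perm.inv_def, Equiv.symm_apply_eq, pairingOf_inl, Equiv.apply_symm_apply]
  rw [vtx, finRotate_eq_permCongr_sigma_mul_swap hn, mul_assoc, swap_mul_eq_mul_swap, h1, h2, ← mul_assoc, pairingOf,
    ← permCongr_mul', show sigma n * pairing p = alpha p from rfl, ncyc_mul_comm]

/-- **`v(π_p) ≤ orb(σπ) + 1`** for every matching. [cite: Heuer2020, Claim 3.11] -/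
theorem vtx_pairingOf_le (hn : 0 < n) (p : Perm (Fin n)) : vtx (n + n) (pairingOf p) ≤ ncyc (alpha p) + 1 := by
  rw [vtx_pairingOf_eq_ncyc hn, ← ncyc_permCongr (posEquiv n) (alpha p)]
  exact ncyc_swap_mul_le_add_one _ _ _

/-- **`v(π_p) = orb(σπ) + 1` when `p 0 = 0`**: the junction transposition then splits the orbit
of `0⁺` ("the orbit of `0⁺` gets split into `O(0⁺, (n−1)⁻)` and `((n−1)⁻, 0⁺)`, thus
`orb(α_z) = orb(α) + 1`", [Heuer2020, proof of Claim 3.11]). [cite: Heuer2020, Claim 3.11] -/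
theorem vtx_pairingOf_eq (hn : 0 < n) (p : Perm (Fin n)) (h0 : p ⟨0, hn⟩ = ⟨0, hn⟩) :
    vtx (n + n) (pairingOf p) = ncyc (alpha p) + 1 := by
  rw [vtx_pairingOf_eq_ncyc hn, ← ncyc_permCongr (posEquiv n) (alpha p)]
  have hsymm : p.symm ⟨0, hn⟩ = ⟨0, hn⟩ := by rw [Equiv.symm_apply_eq, h0]
  refine ncyc_swap_mul_of_sameCycle _ ((posEquiv n).injective.ne Sum.inr_ne_inl) ?_
  rw [sameCycle_permCongr_iff]
  refine ⟨1, ?_⟩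
  rw [zpow_one, alpha_inr, Equiv.symm_apply_apply, finRotate_lastP, hsymm]

/-! ### Rotating `w̃` conjugates `σπ` -/

/-- `Δ`: a rotation of the `w̃`-circle, the identity on the `v`-circle. [folklore] -/
def Del (k : ℕ) : Perm (Fin n ⊕ Fin n) := Perm.sumCongr 1 ((finRotate n ^ k)⁻¹)

/-- **Rotating `w̃` by `k` conjugates `α`**: `α_{σ⁻ᵏ p} = Δ α_p Δ⁻¹`. [folklore] -/
theorem alpha_inv_pow_mul (p : Perm (Fin n)) (k : ℕ) :
    alpha ((finRotate n ^ k)⁻¹ * p) = Del k * alpha p * (Del k)⁻¹ := by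
  have hc : ∀ x, (finRotate n).symm ((finRotate n ^ k)⁻¹ x) = (finRotate n ^ k)⁻¹ ((finRotate n).symm x) := by
    intro x
    rw [← Perm.inv_def, ← Perm.mul_apply, ← Perm.mul_apply]
    congr 1
    exact ((Commute.self_pow (finRotate n) k).inv_right.inv_left).eq
  refine Equiv.ext fun z => ?_
  rcases z with a | b
  · have hinv : (Del k)⁻¹ (Sum.inl a) = (Sum.inl a : Fin n ⊕ Fin n) := by
      rw [Perm.inv_def, Equiv.symm_apply_eq]
      simp [Del]
    rw [Perm.mul_apply, Perm.mul_apply, hinv, alpha_inl, alpha_inl, Perm.mul_apply]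
    simp only [Del, Perm.sumCongr_apply, Sum.map_inr, hc]
  · have hinv : (Del k)⁻¹ (Sum.inr b) = (Sum.inr ((finRotate n ^ k) b) : Fin n ⊕ Fin n) := by
      rw [Perm.inv_def, Equiv.symm_apply_eq]
      simp [Del]
    rw [Perm.mul_apply, Perm.mul_apply, hinv, alpha_inr, alpha_inr]
    simp only [Del, Perm.sumCongr_apply, Sum.map_inl, Perm.one_apply, Sum.inl.injEq]
    rw [Perm.mul_def, Equiv.symm_trans_apply, Perm.inv_def, Equiv.symm_symm]


/-! ### Bardakov's bounds for the query word, in `Fin`-indexed form -/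

/-- Transporting the rotation along `finCongr`. [folklore] -/
theorem permCongr_finCongr_finRotate {a b : ℕ} (h : a = b) : (finCongr h).permCongr (finRotate a) = finRotate b := by
  subst h
  ext x
  simp

/-- **Bardakov's lower bound, `Fin`-indexed**: a non-empty word of the commutator subgroup has
a pairing with `m/2 + 1 ≤ 2 cl + v(π)` (from `Bardakov.exists_isPairingFn_of_mem_commutator`).
[cite: Heuer2020, Thm 2.4] -/
theorem exists_isPairingFn_of_mem_commutator_ofFn {m : ℕ} (hm : 0 < m) (U : Fin m → β × Bool)
    (hmem : FreeGroup.mk (List.ofFn U) ∈ commutator (FreeGroup β)) :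
    ∃ π : Perm (Fin m), IsPairingFn U π ∧ m / 2 + 1 ≤ 2 * commutatorLength (FreeGroup.mk (List.ofFn U)) + vtx m π := by
  classical
  have hne : List.ofFn U ≠ [] := by
    intro h
    have := congrArg List.length h
    simp at this
    omega
  obtain ⟨π₀, hπ₀, hb⟩ := exists_isPairingFn_of_mem_commutator (List.ofFn U) hne hmem
  have hl : (List.ofFn U).length = m := List.length_ofFn
  refine ⟨(finCongr hl).permCongr π₀, ?_, ?_⟩
  · obtain ⟨h1, h2, h3⟩ := hπ₀
    refine ⟨fun i => ?_, fun i => ?_, fun i => ?_⟩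
    · rw [Equiv.permCongr_apply, Equiv.permCongr_apply, Equiv.symm_apply_apply, h1, Equiv.apply_symm_apply]
    · rw [Equiv.permCongr_apply, ne_eq, Equiv.apply_eq_iff_eq_symm_apply]
      exact h2 _
    · have hget : ∀ j, (List.ofFn U).get j = U (finCongr hl j) := fun j => by
        rw [List.get_ofFn]
        rfl
      rw [Equiv.permCongr_apply, ← hget, h3, hget, Equiv.apply_symm_apply]
  · have hvtx : vtx m ((finCongr hl).permCongr π₀) = vtx (List.ofFn U).length π₀ := by
      rw [vtx, vtx, ← permCongr_finCongr_finRotate hl, ← permCongr_mul', ncyc_permCongr]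
    rw [hvtx]
    omega

/-! ### `d_cbi ≤ k` through the commutator lengths of the `n` query words -/

section Main

variable [DecidableEq β]

/-- Orbit counts are unchanged by rotating `w̃`. [folklore] -/
theorem ncyc_alpha_inv_pow_mul (p : Perm (Fin n)) (k : ℕ) : ncyc (alpha ((finRotate n ^ k)⁻¹ * p)) = ncyc (alpha p) := by
  rw [alpha_inv_pow_mul, ncyc_conj]

omit [DecidableEq β] in
/-- A matching against `w` is a matching against the rotated `w̃ = σᵏ w`. [folklore] -/
theorem IsMatching.comp_pow {V W : Fin n → β} {p : Perm (Fin n)} (hp : IsMatching V W p) (k : ℕ) :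
    IsMatching V (W ∘ ⇑(finRotate n ^ k)) ((finRotate n ^ k)⁻¹ * p) := fun i => by
  rw [Function.comp_apply, Perm.mul_apply, Perm.inv_def, Equiv.apply_symm_apply, hp]

omit [DecidableEq β] in
/-- And conversely. [folklore] -/
theorem IsMatching.of_comp_pow {V W : Fin n → β} {p : Perm (Fin n)} {k : ℕ} (hp : IsMatching V (W ∘ ⇑(finRotate n ^ k)) p) :
    IsMatching V W (finRotate n ^ k * p) := fun i => by
  rw [Perm.mul_apply, ← Function.comp_apply (f := W), hp]

omit [DecidableEq β] in
/-- The rotated word is a rotation. [folklore] -/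
theorem ofFn_comp_pow_isRotated (W : Fin n → β) (k : ℕ) : List.IsRotated (List.ofFn (W ∘ ⇑(finRotate n ^ k))) (List.ofFn W) := by
  rw [ofFn_comp_finRotate_pow']
  exact List.IsRotated.forall _ _

/-- **One cheap query suffices** ([Heuer2020, Claim 3.11], "`≤`"): if `cl(v · (σⁱ w)⁻¹) ≤ k` for
some rotation then `d_cbi(v, w) ≤ k`. [cite: Heuer2020, Claim 3.11] -/
theorem dcbi_le_of_commutatorLength_le (hn : 0 < n) {V W : Fin n → β} (h : List.Perm (List.ofFn V) (List.ofFn W))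
    (i k : ℕ) (hcl : commutatorLength (FreeGroup.mk (cword (List.ofFn V) (List.ofFn (W ∘ ⇑(finRotate n ^ i))))) ≤ k) :
    dcbi (List.ofFn V) (List.ofFn W) ≤ k := by
  set W' := W ∘ ⇑(finRotate n ^ i) with hW'
  have h' : List.Perm (List.ofFn V) (List.ofFn W') := h.trans (ofFn_comp_pow_isRotated W i).perm.symm
  rw [← ofFn_cwordFn] at hcl
  obtain ⟨π, hπ, hb⟩ := exists_isPairingFn_of_mem_commutator_ofFn (by omega) (cwordFn V W')
    (by rw [ofFn_cwordFn]; exact mk_cword_mem_commutator h')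
  obtain ⟨p, hp, rfl⟩ := exists_eq_pairingOf hπ
  have hv := vtx_pairingOf_le hn p
  rw [dcbi_congr (List.IsRotated.refl _) (ofFn_comp_pow_isRotated W i).symm, dcbi_le_iff_exists_isMatching h' k]
  refine ⟨p, hp, ?_⟩
  omega

omit [DecidableEq β] in
/-- **The right query succeeds** ([Heuer2020, Claim 3.11], "`≥`"): if `d_cbi(v, w) ≤ k` then
`cl(v · (σⁱ w)⁻¹) ≤ k` for some `i < n` (namely `i = p 0` for a matching `p` maximising
`orb(σπ)`: after that rotation the matching fixes `0`, and the junction splits an orbit).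
[cite: Heuer2020, Claim 3.11] -/
theorem exists_commutatorLength_le_of_dcbi_le (hn : 0 < n) {V W : Fin n → β}
    (h : List.Perm (List.ofFn V) (List.ofFn W)) {k : ℕ} (hk : dcbi (List.ofFn V) (List.ofFn W) ≤ k) :
    ∃ i < n, commutatorLength (FreeGroup.mk (cword (List.ofFn V) (List.ofFn (W ∘ ⇑(finRotate n ^ i))))) ≤ k := by
  obtain ⟨p₀, hp₀, hb⟩ := (dcbi_le_iff_exists_isMatching h k).1 hk
  set i := (p₀ ⟨0, hn⟩).val with hi
  refine ⟨i, (p₀ ⟨0, hn⟩).isLt, ?_⟩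
  set p := (finRotate n ^ i)⁻¹ * p₀ with hpdef
  have hp : IsMatching V (W ∘ ⇑(finRotate n ^ i)) p := hp₀.comp_pow i
  have hp0 : p ⟨0, hn⟩ = ⟨0, hn⟩ := by
    rw [hpdef, Perm.mul_apply, Perm.inv_def, Equiv.symm_apply_eq]
    apply Fin.ext
    rw [val_finRotate_pow]
    simp [hi, Nat.mod_eq_of_lt (p₀ ⟨0, hn⟩).isLt]
  have hv := vtx_pairingOf_eq hn p hp0
  have hnc : ncyc (alpha p) = ncyc (alpha p₀) := ncyc_alpha_inv_pow_mul p₀ i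
  have hB := two_mul_commutatorLength_add_vtx_le (n + n) (cwordFn V (W ∘ ⇑(finRotate n ^ i))) (pairingOf p)
    (isPairingFn_pairingOf hp) (by omega)
  rw [ofFn_cwordFn] at hB
  omega

/-- **`d_cbi(v, w) ≤ k` iff one of the `n` query words `v · (σⁱ w)⁻¹` has commutator length
`≤ k`** — [Heuer2020, Thm. 2 (i) with Claim 3.11]: the questions asked of the CL-`F(A)` oracle
in the proof of Thm. 2 (ii). [cite: Heuer2020, Thm. 2 and Claim 3.11] -/
theorem dcbi_le_iff_exists_commutatorLength_le (hn : 0 < n) {V W : Fin n → β}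
    (h : List.Perm (List.ofFn V) (List.ofFn W)) (k : ℕ) :
    dcbi (List.ofFn V) (List.ofFn W) ≤ k ↔
      ∃ i < n, commutatorLength (FreeGroup.mk (cword (List.ofFn V) (List.ofFn (W ∘ ⇑(finRotate n ^ i))))) ≤ k :=
  ⟨exists_commutatorLength_le_of_dcbi_le hn h, fun ⟨i, _, hi⟩ => dcbi_le_of_commutatorLength_le hn h i k hi⟩

/-- The same for lists: the rotated word is `List.rotate`. [cite: Heuer2020, Thm. 2 and Claim 3.11] -/
theorem dcbi_le_iff_exists_commutatorLength_rotate_le {v w : List β} (h : List.Perm v w) (hv : v ≠ []) (k : ℕ) :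
    dcbi v w ≤ k ↔ ∃ i < v.length, commutatorLength (FreeGroup.mk (cword v (w.rotate i))) ≤ k := by
  have hn : 0 < v.length := List.length_pos_iff.2 hv
  have hl : w.length = v.length := h.length_eq.symm
  set W : Fin v.length → β := fun i => w[i.val]'(by rw [hl]; exact i.isLt) with hW
  have hw : List.ofFn W = w := List.ext_getElem (by simp [hl]) (fun i h1 h2 => by simp [hW])
  have hvV : List.ofFn (fun i : Fin v.length => v[i.val]) = v := List.ofFn_getElem
  have h' : List.Perm (List.ofFn (fun i : Fin v.length => v[i.val])) (List.ofFn W) := by rwa [hvV, hw]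
  have key := dcbi_le_iff_exists_commutatorLength_le hn h' k
  rw [hvV, hw] at key
  rw [key]
  refine exists_congr fun i => and_congr_right fun _ => ?_
  rw [ofFn_comp_finRotate_pow', hw]

/-- For the decision problem: the query element is a yes-instance of CL iff its commutator
length is small (it always lies in `[F, F]` for related words). [cite: Heuer2020, §3.3] -/
theorem mk_cword_rotate_mem_commutator {v w : List β} (h : List.Perm v w) (i : ℕ) :
    FreeGroup.mk (cword v (w.rotate i)) ∈ commutator (FreeGroup β) :=
  mk_cword_mem_commutator (h.trans (List.rotate_perm w i).symm)

end Main

end CBI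

end Literature.GroupTheory.CombinatorialGroupTheory
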